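import Mathlib
import Summits.Ventures.PercRepro2.SwOutMultiRootIneq
import Summits.Ventures.PercRepro2.SwOutMultiRootSides

/-!
# The multi-root core cube: the base of a non-escaping side point and its cube (blind cell
PercRepro2, night-4 g34, 2026-08-29; proofs/NIGHT4-G34.md §6)

At a non-escaping side point `ζ` the base `baseR` is a multi-root base on the extended hull with
the arms `armsR` (**`multiBase_baseR`**, the ten fields from SwOutMultiRootSides), `ζ` is the cube
point `omegaR` of its base (`coreReal_baseR_omegaR`), and along the cube of any multi-root base the
extended hull, the blue part (= the `false` arms), the base and the arms are constant
(`MultiBase.extHullR_coreReal`, `bluePartR_coreReal`, `baseR_coreReal`, `armsR_coreReal`) while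
every root stays non-escaping (`hull_coreReal_subset_U`) — the key of the block decomposition
(SwOutMultiRootThm).
-/

namespace Summit.Ventures.PercRepro2

namespace LocRows

open Hull

variable {V : Type*} {E : Type*}

open scoped Classical

variable {ends : E → Sym2 V}

section NonEscaping

variable [Fintype E] [DecidableEq E] {U : Set V} {ξ : Config E} {l h : V} {R : Set V}
  {𝓤 𝓓 𝓓'' : Set (Set V)} {X : Set V} {𝓤' : Set (Set V)} {F : V → Prop} {ζ : Config E}
  (hl : l ∉ U) (hroot : ∀ e r x, r ∈ R → ends e = s(r, x) → x ∉ R)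
  (hF : ∀ x, F x → ∀ S ∈ 𝓤, x ∈ S)
  (hout : ∀ x ∈ U, x ∉ R →
    F x ∨ x ∈ X ∨ (∃ e y, ends e = s(x, y) ∧ y ∉ U) ∨ (∀ e, x ∉ ends e))
  (hX : ∀ x ∈ X, x ∈ U → ∀ e, x ∈ ends e → ends e = s(x, x))
  (hζ : ζ ∈ gOutSide ends l h 𝓤 𝓓 𝓓'' X 𝓤' U ξ)
  (hne : ∀ r ∈ R, hull ends ζ r ⊆ U)
include hne

omit [Fintype E] [DecidableEq E] hne in
/-- The arm of a vertex of the arm of `y` is the arm of `y`; two arms meeting are equal. -/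
lemma armR_eq_armR_of_mem_of_mem {x y z : V} (hxy : x ∈ armR ends R ζ y)
    (hxz : x ∈ armR ends R ζ z) : armR ends R ζ y = armR ends R ζ z := by
  rw [← armR_eq_of_mem hxy, ← armR_eq_of_mem hxz]

include hl hroot hF hout hX hζ in
/-- **The base of a non-escaping side point is a multi-root base** on the extended hull with the
arms `armsR`. -/
theorem multiBase_baseR :
    MultiBase ends (baseR ends R ζ) R (extHullR ends R ζ) (armsFun (armsR ends R ζ)) where
  root_sub := fun r hr => mem_extHullR_of_mem hr
  bdry_blue := by
    intro e x y hxy hxH hyH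
    by_cases hxR : x ∈ R
    · exact absurd ⟨x, hxR, mem_hull_of_adj_root hxy⟩ hyH
    rcases mem_redPartR_or_bluePartR hxH hxR with hx | hx
    · rw [baseR_apply_of_red hl hF hout hX hζ hne hxy hx]
      obtain ⟨⟨r, hr, hxr⟩, -⟩ := hx
      cases he : ζ e with
      | true => exact absurd ⟨r, hr, Or.inl (mem_cluster_of_edge hxr he hxy)⟩ hyH
      | false => rfl
    · rw [baseR_apply_of_blue hxy hx]
      obtain ⟨⟨r, hr, hxr⟩, -⟩ := hx
      cases he : ζ e with
      | true => rfl
      | false =>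
        exfalso
        have he' : blue ζ e = true := by rw [blue_eq_true_iff]; exact he
        exact hyH ⟨r, hr, Or.inr (mem_cluster_of_edge hxr he' hxy)⟩
  arm_sub := by
    intro P x hx
    obtain ⟨y, hyH, hyR, hP⟩ := exists_of_mem_armsR P.2
    change x ∈ P.1 at hx
    rw [hP] at hx
    exact armR_subset hyH hyR hx
  arm_nonempty := by
    intro P
    obtain ⟨y, -, -, hP⟩ := exists_of_mem_armsR P.2
    refine ⟨y, ?_⟩
    change y ∈ P.1
    rw [hP]; exact mem_armR_self y
  arm_disj := by
    intro P Q hPQ x hxP hxQ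
    obtain ⟨y, -, -, hP⟩ := exists_of_mem_armsR P.2
    obtain ⟨z, -, -, hQ⟩ := exists_of_mem_armsR Q.2
    change x ∈ P.1 at hxP
    change x ∈ Q.1 at hxQ
    apply hPQ
    apply Subtype.ext
    rw [hP] at hxP
    rw [hQ] at hxQ
    rw [hP, hQ]
    exact armR_eq_armR_of_mem_of_mem hxP hxQ
  arm_cover := fun x hx hxR =>
    ⟨⟨armR ends R ζ x, armR_mem_armsR_of_mem_extHullR hx hxR⟩, mem_armR_self x⟩
  no_cross := by
    intro P Q hPQ e x y hxy hxP hyQ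
    obtain ⟨p, hpH, hpR, hP⟩ := exists_of_mem_armsR P.2
    obtain ⟨q, hqH, hqR, hQ⟩ := exists_of_mem_armsR Q.2
    change x ∈ P.1 at hxP
    change y ∈ Q.1 at hyQ
    rw [hP] at hxP
    rw [hQ] at hyQ
    have hxH := armR_subset hpH hpR hxP
    have hyH := armR_subset hqH hqR hyQ
    have h1 := armR_eq_of_edge hxy hxH hyH
    apply hPQ
    apply Subtype.ext
    rw [hP, hQ, ← armR_eq_of_mem hxP, ← armR_eq_of_mem hyQ, h1]
  root_edges := fun e r x hr hrx =>
    ⟨⟨armR ends R ζ x, armR_mem_armsR hr hrx (hroot e r x hr hrx)⟩, mem_armR_self x⟩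
  root_red := by
    intro e r x hr hrx
    have hxR := hroot e r x hr hrx
    have hxH : x ∈ extHullR ends R ζ := ⟨r, hr, mem_hull_of_adj_root hrx⟩
    rcases mem_redPartR_or_bluePartR hxH hxR with hx | hx
    · rw [baseR_apply_of_red hl hF hout hX hζ hne (ends_swap hrx) hx]
      cases he : ζ e with
      | true => rfl
      | false =>
        exfalso
        have he' : blue ζ e = true := by rw [blue_eq_true_iff]; exact he
        exact redPartR_disjoint_bluePartR hl hF hout hX hζ hne hx
          ⟨⟨r, hr, mem_cluster_of_edge (mem_cluster_self _ _ _) he' hrx⟩, hxR⟩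
    · rw [baseR_apply_of_blue (ends_swap hrx) hx]
      cases he : ζ e with
      | true =>
        exfalso
        exact redPartR_disjoint_bluePartR hl hF hout hX hζ hne
          ⟨⟨r, hr, mem_cluster_of_edge (mem_cluster_self _ _ _) he hrx⟩, hxR⟩ hx
      | false => rfl
  conn := by
    intro P x hx
    obtain ⟨y, hyH, hyR, hP⟩ := exists_of_mem_armsR P.2
    change x ∈ P.1 at hx
    have hP' : armsFun (armsR ends R ζ) P = P.1 := rfl
    rw [hP'] 
    rw [hP] at hx ⊢
    have hxH := armR_subset hyH hyR hx
    have harm : armR ends R ζ x = armR ends R ζ y := armR_eq_of_mem hx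
    rcases mem_redPartR_or_bluePartR hxH.1 hxH.2 with hxr | hxr
    · obtain ⟨r, hr, hc⟩ := exists_root_conn_inside_red hxr
      refine ⟨r, hr, ?_⟩
      rw [harm] at hc
      have hsub : armR ends R ζ y ⊆ redPartR ends R ζ := by
        rw [← harm]; exact armR_subset_redPartR hl hF hout hX hζ hne hxr
      rw [insideConfig_baseR_of_red hl (fun e r hr h' => hroot e r r hr h' hr) hF hout hX hζ hne hsub hr]
      exact hc
    · obtain ⟨r, hr, hc⟩ := exists_root_conn_inside_blue hxr
      refine ⟨r, hr, ?_⟩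
      rw [harm] at hc
      have hsub : armR ends R ζ y ⊆ bluePartR ends R ζ := by
        rw [← harm]; exact armR_subset_bluePartR hl hF hout hX hζ hne hxr
      rw [insideConfig_baseR_of_blue (fun e r hr h' => hroot e r r hr h' hr) hsub hr]
      exact hc

include hl hF hout hX hζ in
/-- The arms assigned `false` by `omegaR` are exactly the blue part. -/
lemma armsFalseC_omegaR :
    armsFalseC (armsFun (armsR ends R ζ)) (omegaR ends R ζ) = bluePartR ends R ζ := by
  ext x
  constructor
  · rintro ⟨P, hP, hx⟩
    have : P.1 ⊆ bluePartR ends R ζ := by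
      by_contra h'
      simp only [omegaR, decide_eq_false_iff_not, not_not] at hP
      exact h' hP
    exact this hx
  · intro hx
    have hxH : x ∈ extHullR ends R ζ := bluePartR_subset hx
    refine ⟨⟨armR ends R ζ x, armR_mem_armsR_of_mem_extHullR hxH hx.2⟩, ?_, mem_armR_self x⟩
    simp only [omegaR, decide_eq_false_iff_not, not_not]
    exact armR_subset_bluePartR hl hF hout hX hζ hne hx

include hl hF hout hX hζ in
/-- **The side point is the cube point `omegaR` of its base.** -/
theorem coreReal_baseR_omegaR :
    coreReal ends (armsFun (armsR ends R ζ)) (baseR ends R ζ) (omegaR ends R ζ) = ζ := by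
  unfold coreReal
  rw [armsFalseC_omegaR hl hF hout hX hζ hne, baseR, Hull.flip_flip]

end NonEscaping

section CubePoints

variable {ι : Type*} {A : ι → Set V} {b : Config E} {R H : Set V}
  (hb : MultiBase ends b R H A)
include hb

/-- At a cube point with `A i` red, the red edges of the base inside `A i ∪ {r}` are red. -/
lemma MultiBase.insideConfig_le_coreReal {ω : Config ι} {i : ι} (hi : ω i = true) {r : V}
    (hr : r ∈ R) : insideConfig ends (A i ∪ {r}) b ≤ coreReal ends A b ω := by
  intro e
  by_cases he : insideConfig ends (A i ∪ {r}) b e = true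
  · rw [he]
    obtain ⟨hbe, x, hx, y, hy, hxy⟩ := insideConfig_eq_true_iff.1 he
    rcases hx with hx | hx
    · rw [hb.coreReal_apply_of_mem hxy hx, if_pos hi, hbe]
    · rcases hy with hy | hy
      · rw [hb.coreReal_apply_of_mem (ends_swap hxy) hy, if_pos hi, hbe]
      · rw [Set.mem_singleton_iff] at hx hy
        rcases hx with rfl; rcases hy with rfl
        exact absurd hxy (hb.loop_root hr e)
  · simp only [Bool.not_eq_true] at he
    rw [he]; exact Bool.false_le _

/-- At a cube point with `A i` blue, the red edges of the base inside `A i ∪ {r}` are blue. -/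
lemma MultiBase.insideConfig_le_blue_coreReal {ω : Config ι} {i : ι} (hi : ω i = false) {r : V}
    (hr : r ∈ R) : insideConfig ends (A i ∪ {r}) b ≤ blue (coreReal ends A b ω) := by
  intro e
  by_cases he : insideConfig ends (A i ∪ {r}) b e = true
  · rw [he]
    obtain ⟨hbe, x, hx, y, hy, hxy⟩ := insideConfig_eq_true_iff.1 he
    have hi' : ω i ≠ true := by rw [hi]; decide
    rcases hx with hx | hx
    · rw [blue_apply, hb.coreReal_apply_of_mem hxy hx, if_neg hi', hbe]; rfl
    · rcases hy with hy | hy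
      · rw [blue_apply, hb.coreReal_apply_of_mem (ends_swap hxy) hy, if_neg hi', hbe]; rfl
      · rw [Set.mem_singleton_iff] at hx hy
        rcases hx with rfl; rcases hy with rfl
        exact absurd hxy (hb.loop_root hr e)
  · simp only [Bool.not_eq_true] at he
    rw [he]; exact Bool.false_le _

/-- Every vertex of an arm lies in the hull of some root at every cube point. -/
theorem MultiBase.mem_extHullR_coreReal (ω : Config ι) {x : V} (hx : x ∈ H) :
    x ∈ extHullR ends R (coreReal ends A b ω) := by
  by_cases hxR : x ∈ R
  · exact mem_extHullR_of_mem hxR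
  obtain ⟨i, hi⟩ := hb.arm_cover x hx hxR
  obtain ⟨r, hr, hc⟩ := hb.conn i x hi
  refine ⟨r, hr, ?_⟩
  cases hωi : ω i with
  | true => exact Or.inl (cluster_mono (hb.insideConfig_le_coreReal hωi hr) r hc)
  | false => exact Or.inr (cluster_mono (hb.insideConfig_le_blue_coreReal hωi hr) r hc)

/-- **The extended hull is constant along the cube.** -/
theorem MultiBase.extHullR_coreReal (ω : Config ι) :
    extHullR ends R (coreReal ends A b ω) = H := by
  apply Set.Subset.antisymm
  · rintro x ⟨r, hr, hx⟩
    exact hb.hull_subset ω hr hx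
  · intro x hx
    exact hb.mem_extHullR_coreReal ω hx

/-- **The blue part of a cube point is the union of its `false` arms.** -/
theorem MultiBase.bluePartR_coreReal (ω : Config ι) :
    bluePartR ends R (coreReal ends A b ω) = armsFalseC A ω := by
  ext x
  constructor
  · rintro ⟨⟨r, hr, hx⟩, hxR⟩
    rcases hb.mem_root_or_false_of_mem_cluster_blue ω hr hx with h' | ⟨i, hi, hxi⟩
    · exact absurd h' hxR
    · exact ⟨i, hi, hxi⟩
  · rintro ⟨i, hi, hxi⟩
    obtain ⟨r, hr, hc⟩ := hb.conn i x hxi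
    exact ⟨⟨r, hr, cluster_mono (hb.insideConfig_le_blue_coreReal hi hr) r hc⟩,
      (hb.arm_sub i x hxi).2⟩

/-- **The base is constant along the cube.** -/
theorem MultiBase.baseR_coreReal (ω : Config ι) : baseR ends R (coreReal ends A b ω) = b := by
  unfold baseR
  rw [hb.bluePartR_coreReal ω]
  unfold coreReal
  rw [Hull.flip_flip]

/-- **The arms are constant along the cube.** -/
theorem MultiBase.armsR_coreReal [Fintype E] [DecidableEq E] (ω : Config ι) (hH : extHullR ends R b = H) :
    armsR ends R (coreReal ends A b ω) = armsR ends R b := by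
  apply armsR_congr
  rw [hb.extHullR_coreReal ω, hH]

/-- Every root is non-escaping at every cube point (`H ⊆ U`). -/
theorem MultiBase.hull_coreReal_subset_U {U : Set V} (hHU : H ⊆ U) (ω : Config ι) {r : V}
    (hr : r ∈ R) : hull ends (coreReal ends A b ω) r ⊆ U :=
  (hb.hull_subset ω hr).trans hHU

omit hb in
/-- The base itself is the cube point `⊤`. -/
lemma MultiBase.coreReal_top : coreReal ends A b (fun _ => true) = b := by
  unfold coreReal
  have : armsFalseC A (fun _ => true) = ∅ := by
    ext x; simp [armsFalseC]
  rw [this]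
  funext e
  rw [flip_apply_of_notMem]
  rintro ⟨x, hx, -⟩
  exact hx

end CubePoints

end LocRows

end Summit.Ventures.PercRepro2
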